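import Literature.MathematicalPhysics.QuantumFieldTheory.BalabanImbrieJaffe1984to88.BIJ85ScalarPropagatorTorusK

/-!
# `BalabanImbrieJaffe1984to88.BIJ88NeumannNoZeroModesTorus` — T. Bałaban, J. Imbrie, A. Jaffe, *Effective action and cluster properties
of the abelian Higgs model*, Commun. Math. Phys. **114** (1988) 257–315 [BalabanImbrieJaffe1988], Sect. 2 p. 262–263 [PDF 6–7] (*"the
η-lattice propagators G_k(Ω,u) defined on subsets Ω ⊂ T_η with Neumann boundary conditions"*, the Neumann propagators `G_k(□_α,u)` of
(2.27)), with [I] = T. Bałaban, J. Imbrie, A. Jaffe, CMP **97** (1985) [BalabanImbrieJaffe1985] (4.6.2) p. 313 and p. 309: **NO ZERO MODES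
OF THE NEUMANN PROBLEM ON A REGION `Ω`** of the torus of record — the transport argument of [I] p. 309 LOCALIZED to a union of `k`-blocks —
the invertibility behind `G_k(Ω,u)` (companion file `BIJ88NeumannPropagator227Torus` builds the propagator on it).

statement-level skeleton of published theorems with citation tags; proofs where landed; nothing here is a claim about the Yang–Mills mass gap

PDF held: `paper:balaban1988-cmp114-bij-abelian-higgs-effective-action` (journal page = PDF page + 256); p. 262–263 [PDF 6–7] read as
images this session (renders `HOME/lit-balaban-p31/renders/original-p006-x2.png`, `original-p007-x2.png`); [I] p. 309 [PDF 11], p. 313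
[PDF 15] (`paper:balaban1985-cmp97-bij-higgs-minimizers`, journal page = PDF page + 298) as quoted in p11's `BIJ85ScalarPropagatorTorusK`.

CITATION HEADER (lean-in-tree rule).  Part of the lit-balaban TYPED SKELETON (HOME `run/shared/lean/pub/lit-balaban/`), PHASE-2 proof
seat p31 gen 15 (unit `lit-balaban-p31-g15`; TAKING line HOME/STATUS.md 2026-08-22T10:49:49Z; free-target protocol G.5-34(d) — the item
*"G_k(□,u) WITH BODY on V1 torus cubes"* recorded as successor item 2 (i) of the owner's `HOME/lit-balaban-r18/C2S14-CLOSURE.md` §5).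
WHAT IS REPRODUCED: toward row **C2.Eq2.27** of `HOME/lit-balaban-r18/ROWS-C2.md` (owner r18; the Neumann propagators `G_k(□_α,u)` on the
cubes `□_α`) and row **C1.Eq4.6.2-4.6.4** of `HOME/lit-balaban-r15/ROWS-C1.md` (owner r15; [I] (4.6.2), whose torus instance on the WHOLE
torus is p11's `BIJ85ScalarPropagatorTorusK`): the REGION version of [I]'s no-zero-modes statement, kind «model instance» (two definitions
with bodies `innerK`, `IsBlockUnion` + theorems; no `Prop`-valued fact introduced).

THE PRINTED TEXT (verbatim).  p. 262–263 [PDF 6–7]: *"In the scalar field sector, we have the η-lattice propagators G_k(Ω,u) defined on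
subsets Ω ⊂ T_η with Neumann boundary conditions. To localize the dependence on u, we interpolate in a smooth fashion between operators with
Neumann boundary conditions on small cubes. Let {□_α} be the collection of (1/2L) r(e_{k−1})-cubes that can be built from cubes of size
M = O(1) as in [6]."*  [I] p. 313 [PDF 15]: *"G_k(u_k) = [−Δ_{u_k} + a_kQ_k^*(u_k)Q_k(u_k)]^{−1}, (4.6.2) where −Δ_{u_k} = D^*_{u_k}D_{u_k}.
(4.6.3)"*; [I] p. 309 [PDF 11]: *"Such zero modes do not occur … Similar, elementary reasoning yields an inductive proof for k > 1, but we
leave out the details."*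

WHAT IS AT STAKE.  `G_k(Ω,u)` is the inverse, on the scalar fields supported in `Ω`, of the *"basic quadratic form with Neumann boundary
conditions on Ω"* (5.6.10) `−Δ^N_{u,Ω} = D_u^*χ_{Ω*}D_u` (only the bonds `b ⊂ Ω`) plus `a_kQ_k^*(u)Q_k(u)` (the `k`-level covariant average
of [I] (2.6)/(4.6.1) over the `k`-blocks inside `Ω`).  It exists iff the form has no zero modes on `Ω`: `D_uφ = 0` on `Ω*` and `Q_k(u)φ = 0`
on the blocks inside `Ω` must force `φ|_Ω = 0`.  p11's `BIJ85ScalarPropagatorTorusK.eq_zero_of_covD_eq_zero_of_qCovK_eq_zero` proves this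
for `Ω = T` from the rule `u_bφ(b₊) = φ(b₋)` on EVERY bond; on a proper `Ω` the rule is available only on `Ω*`, and the point of this file is
that the printed transport never uses any other bond.

THE MECHANISM (the argument of [I] p. 309, localized).  (§1) `Ω` is a *union of `k`-blocks* (`IsBlockUnion k Ω`: with every site it
contains the whole block `B^k(x_k)` of p11's `blockK`/`blkIter`; the cubes `□_α`, unions of `M`-cubes of the unit lattice, are such);
`innerK k Ω` = the unit-lattice sites `y` with `B^k(y) ⊆ Ω`; one level down the block `B(y)` of an inner site and its corner are inner
(`block_subset_innerK`, `corner_mem_innerK`).  (§2) The composite contour `Γ^{(k)}_{yx}` of [I] (5.1.3) never leaves `B^k(y)`: the legs of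
`Γ_{yx}` stay in `B(y)` (`legBond_mem_starB_block`, from p11's `blockOf_legSite`), and the straight run of `L` unit bonds realizing the
`L`-lattice bond `⟨y, y′⟩` stays in `B(y) ∪ B(y′)` (`runBond_corner_mem_starB`).  Hence the rule `u_bφ(b₊) = φ(b₋)` ON `Ω*` ALONE gives
`u(Γ_{yx})φ(x) = φ(y)` for blocks inside `Ω` (`holC_mul_eq_corner_of`, `qCov_eq_corner_of`), climbs the levels inside `Ω`
(`transport_qCovK_of`: `u^{(k)}_c(Q_kφ)(c₊) = (Q_kφ)(c₋)` for bonds joining inner sites), gives `(Q_k(u)φ)(y) = φ(y_corner)` for inner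
`y` (`qCovK_eq_cornerIter_of`) and `u(Γ^{(k)}_{x_k,x})φ(x) = φ(x_k)` whenever `B^k(x_k) ⊆ Ω` (`holCK_mul_eq_of`); so `Q_k(u)φ = 0` on the inner
blocks kills the corner values and the transport kills the rest: **`φ|_Ω = 0`** (`eq_zero_on_of_covD_qCovK`) — for EVERY `U(1)` field `u`,
`c ≠ 0`, standing range `j + k ≤ m + K`, no small-field or gauge condition.

WHAT IS PROVED (0 `sorry`, standard axioms; two definitions with bodies + theorems, no `Prop` facts).
* §1 `innerK`, `IsBlockUnion`, `mem_innerK`, `mem_innerK_zero`, `blockK_subset_blockK_succ`, `block_subset_innerK`, `corner_mem_innerK`,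
  `starB_subset_starB`, `IsBlockUnion.of_succ`, `isBlockUnion_zero`, `isBlockUnion_univ`, `isBlockUnion_biUnion`, `isBlockUnion_blockK`,
  `IsBlockUnion.blkIter_mem`.
* §2 `prod_legBond_mul_eq_of`, `legBond_mem_starB_block`, **`holC_mul_eq_corner_of`**, **`qCov_eq_corner_of`**, `runBond_corner_mem_starB`,
  `prod_runBond_mul_eq_of`, **`lineU_mul_eq_of`**, **`transport_qCovK_of`**, **`qCovK_eq_cornerIter_of`**, **`holCK_mul_eq_of`**,
  **`eq_zero_on_of_covD_qCovK`**.
HONEST SCOPE.  Transport/combinatorics only (the one-level lemmas are p11's `BIJ85BlockAveragesTorus`/`…TorusK` proofs re-run with a bond-set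
side condition; nothing of p11's is re-declared).  The operator, its inverse `G_k(Ω,u)`, (5.6.11) in a fixed region and the gauge covariance
are the companion files `BIJ88NeumannPropagator227Torus` / `BIJ88DeltaLoc234Torus` of this seat.  Unit `lit-balaban-p31`
(literature-prover-lit-balaban-p31-g15-0), 2026-08-22.  NOT summit progress.
-/

open scoped BigOperators
open Finset

namespace Literature.MathematicalPhysics.QuantumFieldTheory.BalabanImbrieJaffe1984to88.BIJ88NeumannNoZeroModesTorus

open Literature.MathematicalPhysics.QuantumFieldTheory.Balaban1983to89
open BIJ88Sect3Statements (U1 toC cfg covD starB mem_starB)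
open BIJ88RenormTransf311 (inBlock)
open BIJ85BlockAveragesTorus BIJ85BlockAveragesTorusK
open BIJ85ScalarPropagatorTorus (covD_eq_zero_iff)

noncomputable section

variable {P : Params} {j : ℕ}


/-! ## §1 Regions: unions of `k`-blocks, the coarse sites inside `Ω` -/

/-- The sites `y` of the unit lattice `T^{(j+k)}` whose `k`-block `B^k(y)` lies inside `Ω ⊂ T^{(j)}` — the rows of `Q_k(u)` kept by the
Neumann problem on `Ω` (`a_kQ_k^*(u)Q_k(u)` restricted to `Ω`). [cite: BalabanImbrieJaffe1988, (2.27) p.263] -/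
def innerK (k : ℕ) (Ω : Finset (Balaban1983to89.Site P j)) : Finset (Balaban1983to89.Site P (j+k)) :=
  univ.filter fun y => blockK k y ⊆ Ω

/-- `Ω` is a union of `k`-blocks (p. 263: the cubes `□_α` *"built from cubes of size M"* of the unit lattice; every `r(e_k)`-cube of
`T^{(k)}_1` read on `T_η` is such a union). [cite: BalabanImbrieJaffe1988, (2.27) p.263] -/
def IsBlockUnion (k : ℕ) (Ω : Finset (Balaban1983to89.Site P j)) : Prop :=
  ∀ x ∈ Ω, blockK k (blkIter k x) ⊆ Ω

/-- kernel: membership in `innerK`. [cite: BalabanImbrieJaffe1988, (2.27) p.263] -/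
theorem mem_innerK {k : ℕ} {Ω : Finset (Balaban1983to89.Site P j)} {y : Balaban1983to89.Site P (j+k)} :
    y ∈ innerK k Ω ↔ blockK k y ⊆ Ω := by
  simp [innerK]

/-- kernel: at level `0` the inner sites are `Ω` itself. [cite: BalabanImbrieJaffe1988, (2.27) p.263] -/
theorem mem_innerK_zero {Ω : Finset (Balaban1983to89.Site P j)} {y : Balaban1983to89.Site P j} :
    y ∈ innerK 0 Ω ↔ y ∈ Ω := by
  rw [mem_innerK, blockK_zero, singleton_subset_iff]

/-- kernel: `B^k(z) ⊆ B^{k+1}(y)` for `z ∈ B(y)`. [cite: BalabanImbrieJaffe1985, (5.1.2)–(5.1.3) p.313] -/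
theorem blockK_subset_blockK_succ (k : ℕ) {y : Balaban1983to89.Site P (j+k+1)} {z : Balaban1983to89.Site P (j+k)} (hz : z ∈ block y) :
    blockK k z ⊆ blockK (k+1) y := by
  rw [blockK_succ]
  exact subset_biUnion_of_mem (fun z => blockK k z) hz

/-- kernel: the block of an inner site of level `k+1` consists of inner sites of level `k`. [cite: BalabanImbrieJaffe1988, (2.27) p.263] -/
theorem block_subset_innerK {k : ℕ} {Ω : Finset (Balaban1983to89.Site P j)} {y : Balaban1983to89.Site P (j+k+1)}
    (hy : y ∈ innerK (k+1) Ω) : block y ⊆ innerK k Ω := fun _ hz =>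
  mem_innerK.2 ((blockK_subset_blockK_succ k hz).trans (mem_innerK.1 hy))

/-- kernel: the corner of an inner site of level `k+1` is an inner site of level `k` (standing range). [cite: BalabanImbrieJaffe1988, (2.27) p.263] -/
theorem corner_mem_innerK {k : ℕ} (hk : j + k + 1 ≤ P.m + P.K) {Ω : Finset (Balaban1983to89.Site P j)}
    {y : Balaban1983to89.Site P (j+k+1)} (hy : y ∈ innerK (k+1) Ω) : corner y ∈ innerK k Ω :=
  block_subset_innerK hy (corner_mem_block hk y)

/-- kernel: `X* ⊆ Y*` for `X ⊆ Y` (r16/p31 gen 6 `starB_mono`, restated privately to keep the import light). [cite: BalabanImbrieJaffe1988, (3.5) p.266] -/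
private theorem starB_subset_starB {n : ℕ} {X Y : Finset (Balaban1983to89.Site P n)} (h : X ⊆ Y) : starB X ⊆ starB Y := fun b hb =>
  (mem_starB Y b).2 ⟨h ((mem_starB X b).1 hb).1, h ((mem_starB X b).1 hb).2⟩

/-- kernel: a `(k+1)`-block union is a `k`-block union. [cite: BalabanImbrieJaffe1988, (2.27) p.263] -/
theorem IsBlockUnion.of_succ {k : ℕ} {Ω : Finset (Balaban1983to89.Site P j)} (hΩ : IsBlockUnion (k+1) Ω) : IsBlockUnion k Ω :=
  fun x hx => (blockK_subset_blockK_succ k (mem_block_iff.2 rfl)).trans (hΩ x hx)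

/-- kernel: every `Ω` is a `0`-block union. [cite: BalabanImbrieJaffe1988, (2.27) p.263] -/
theorem isBlockUnion_zero (Ω : Finset (Balaban1983to89.Site P j)) : IsBlockUnion 0 Ω := fun x hx => by
  rw [blkIter_zero, blockK_zero, singleton_subset_iff]; exact hx

/-- kernel: the whole torus is a union of `k`-blocks. [cite: BalabanImbrieJaffe1988, (2.27) p.263] -/
theorem isBlockUnion_univ (k : ℕ) : IsBlockUnion k (univ : Finset (Balaban1983to89.Site P j)) := fun _ _ => subset_univ _

/-- kernel: a union of `k`-blocks over any set of block labels is a `k`-block union. [cite: BalabanImbrieJaffe1988, (2.27) p.263] -/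
theorem isBlockUnion_biUnion (k : ℕ) (S : Finset (Balaban1983to89.Site P (j+k))) : IsBlockUnion k (S.biUnion fun y => blockK (j := j) k y) := by
  intro x hx
  obtain ⟨y, hy, hxy⟩ := mem_biUnion.1 hx
  rw [mem_blockK.1 hxy]
  exact subset_biUnion_of_mem (fun y => blockK k y) hy

/-- kernel: one block `B^k(y)` is a `k`-block union. [cite: BalabanImbrieJaffe1988, (2.27) p.263] -/
theorem isBlockUnion_blockK (k : ℕ) (y : Balaban1983to89.Site P (j+k)) : IsBlockUnion k (blockK (j := j) k y) := fun x hx => by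
  rw [mem_blockK.1 hx]

/-- kernel: in a `k`-block union, the block point of a site of `Ω` is inner. [cite: BalabanImbrieJaffe1988, (2.27) p.263] -/
theorem IsBlockUnion.blkIter_mem {k : ℕ} {Ω : Finset (Balaban1983to89.Site P j)} (hΩ : IsBlockUnion k Ω) {x : Balaban1983to89.Site P j}
    (hx : x ∈ Ω) : blkIter k x ∈ innerK k Ω :=
  mem_innerK.2 (hΩ x hx)

/-! ## §2 Transport along the composite contours INSIDE `Ω` (the argument of [I] p. 309 localized); no zero modes on `Ω` -/

section Transport

variable {U : GaugeField P j U1} {φ : Balaban1983to89.Site P j → ℂ}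

/-- Transport along one leg of `Γ_{yx}` using the rule `u_bφ(b₊) = φ(b₋)` only on a bond set `S` containing the leg.
[cite: BalabanImbrieJaffe1985, (2.5) p.302] -/
theorem prod_legBond_mul_eq_of {S : Finset (PBond P j)} (hcov : ∀ b ∈ S, toC (U b) * φ b.tgt = φ b.src)
    (x : Balaban1983to89.Site P j) (μ : Fin P.d) :
    ∀ n : ℕ, (∀ t < n, legBond x μ t ∈ S) →
      (∏ t ∈ range n, toC (U (legBond x μ t))) * φ (legSite x μ n) = φ (legSite x μ 0)
  | 0, _ => by rw [prod_range_zero, one_mul]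
  | n + 1, hS => by
    rw [prod_range_succ, mul_assoc, ← legBond_tgt x μ n, hcov _ (hS n (Nat.lt_succ_self n))]
    exact prod_legBond_mul_eq_of hcov x μ n fun t ht => hS t (Nat.lt_succ_of_lt ht)

/-- kernel: the leg bonds of `Γ_{yx}` lie inside the block of `x` (both end-points; standing range).
[cite: BalabanImbrieJaffe1985, (2.4) p.302] -/
theorem legBond_mem_starB_block (hj : j + 1 ≤ P.m + P.K) (x : Balaban1983to89.Site P j) (μ : Fin P.d) {t : ℕ} (ht : t < inBlock x μ) :
    legBond x μ t ∈ starB (block (blockOf x)) := by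
  have hL : inBlock x μ < P.L := Nat.mod_lt _ P.L_pos
  rw [mem_starB, legBond_tgt]
  refine ⟨mem_block_iff.2 ?_, mem_block_iff.2 ?_⟩
  · exact blockOf_legSite hj x μ ⟨t, by omega⟩
  · exact blockOf_legSite hj x μ ⟨t + 1, by omega⟩

/-- **`u(Γ_{yx})φ(x) = φ(y)`** (`y` the corner of the block of `x`) as soon as `u_bφ(b₊) = φ(b₋)` holds on the bonds INSIDE THE BLOCK of
`x` — the transport of [I] p. 309 uses no bond outside `B(y)`. [cite: BalabanImbrieJaffe1985, (2.6) p.303] -/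
theorem holC_mul_eq_corner_of (hj : j + 1 ≤ P.m + P.K) (x : Balaban1983to89.Site P j)
    (hcov : ∀ b ∈ starB (block (blockOf x)), toC (U b) * φ b.tgt = φ b.src) :
    holC U x * φ x = φ (corner (blockOf x)) := by
  have step : ∀ μ : Fin P.d, legProd U x μ * φ (junction x μ) = φ (junction x (μ + 1)) := by
    intro μ
    have h := prod_legBond_mul_eq_of hcov x μ (inBlock x μ) fun t ht => legBond_mem_starB_block hj x μ ht
    rw [legSite_inBlock hj, legSite_zero] at h
    exact h
  set F : ℕ → ℂ := fun i => if h : i < P.d then legProd U x ⟨i, h⟩ else 1 with hF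
  have hFμ : ∀ μ : Fin P.d, F μ = legProd U x μ := fun μ => by simp only [hF, μ.isLt, dif_pos]
  have tel : ∀ n : ℕ, n ≤ P.d → (∏ i ∈ range n, F i) * φ x = φ (junction x n) := by
    intro n
    induction n with
    | zero => intro _; rw [prod_range_zero, one_mul, junction_zero]
    | succ n ih =>
      intro hn
      have hn' : n < P.d := Nat.lt_of_succ_le hn
      rw [prod_range_succ, mul_comm (∏ i ∈ range n, F i) (F n), mul_assoc, ih hn'.le, hFμ ⟨n, hn'⟩]
      exact step ⟨n, hn'⟩
  have hd := tel P.d le_rfl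
  rw [junction_d] at hd
  have e : holC U x = ∏ i ∈ range P.d, F i := by
    unfold holC
    rw [← Fin.prod_univ_eq_prod_range F P.d]
    exact prod_congr rfl fun μ _ => (hFμ μ).symm
  rw [e, hd]

/-- **`(Q(u)φ)(y) = φ(y)`** (corner value) as soon as the transport rule holds on the bonds inside `B(y)`.
[cite: BalabanImbrieJaffe1985, (2.6) p.303] -/
theorem qCov_eq_corner_of (hj : j + 1 ≤ P.m + P.K) (y : Balaban1983to89.Site P (j+1))
    (hcov : ∀ b ∈ starB (block y), toC (U b) * φ b.tgt = φ b.src) : qCov U φ y = φ (corner y) := by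
  rw [qCov_apply]
  have h : ∀ x ∈ block y, holC U x * φ x = φ (corner y) := fun x hx => by
    have hx' := mem_block_iff.1 hx
    rw [holC_mul_eq_corner_of hj x (by rw [hx']; exact hcov), hx']
  rw [sum_congr rfl h, sum_const, Balaban1983to89.Site.card_block hj, nsmul_eq_mul]
  push_cast
  have hL : ((P.L : ℂ) ^ P.d) ≠ 0 := pow_ne_zero _ (by exact_mod_cast P.L_pos.ne')
  rw [← mul_assoc, inv_mul_cancel₀ hL, one_mul]

/-- kernel: the unit bonds of the `L`-lattice bond `⟨y, y+e_μ⟩` (the straight run from corner to corner) lie inside `B(y) ∪ B(y+e_μ)`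
(standing range). [cite: BalabanImbrieJaffe1985, (2.10) p.303] -/
theorem runBond_corner_mem_starB (hj : j + 1 ≤ P.m + P.K) (c : PBond P (j+1)) {t : ℕ} (ht : t < P.L) :
    runBond (corner c.src) c.dir t ∈ starB (block c.src ∪ block c.tgt) := by
  have h0 : inBlock (corner c.src) c.dir = 0 := inBlock_corner hj c.src c.dir
  have hsrc : ∀ {s : ℕ}, s < P.L → blockOf (runSite (corner c.src) c.dir s) = c.src := fun {s} hs => by
    rw [blockOf_runSite_lo hj (corner c.src) c.dir (t := s) (by rw [h0]; omega), blockOf_corner hj]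
  rw [mem_starB, runBond_tgt]
  refine ⟨mem_union_left _ (mem_block_iff.2 (hsrc ht)), ?_⟩
  rcases Nat.lt_or_ge (t + 1) P.L with h1 | h1
  · exact mem_union_left _ (mem_block_iff.2 (hsrc h1))
  · have ht1 : t + 1 = P.L := by omega
    refine mem_union_right _ (mem_block_iff.2 ?_)
    rw [ht1, ← corner_shift hj, blockOf_corner hj]
    rfl

/-- Transport along the straight run using the rule only on a bond set `S` containing the run. [cite: BalabanImbrieJaffe1985, (2.5) p.302] -/
theorem prod_runBond_mul_eq_of {S : Finset (PBond P j)} (hcov : ∀ b ∈ S, toC (U b) * φ b.tgt = φ b.src)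
    (x : Balaban1983to89.Site P j) (μ : Fin P.d) :
    ∀ n : ℕ, (∀ t < n, runBond x μ t ∈ S) → (∏ t ∈ range n, toC (U (runBond x μ t))) * φ (runSite x μ n) = φ x
  | 0, _ => by rw [prod_range_zero, one_mul, runSite_zero]
  | n + 1, hS => by
    rw [prod_range_succ, mul_assoc, ← runBond_tgt x μ n, hcov _ (hS n (Nat.lt_succ_self n))]
    exact prod_runBond_mul_eq_of hcov x μ n fun t ht => hS t (Nat.lt_succ_of_lt ht)

/-- **`u(Γ_{yy′})φ(y′) = φ(y)`** for the `L`-lattice bond `c = ⟨y, y′⟩` (corners read in `T^{(j)}`) as soon as the transport rule holds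
inside `B(y) ∪ B(y′)`. [cite: BalabanImbrieJaffe1985, (4.6.2) p.313] -/
theorem lineU_mul_eq_of (hj : j + 1 ≤ P.m + P.K) (c : PBond P (j+1))
    (hcov : ∀ b ∈ starB (block c.src ∪ block c.tgt), toC (U b) * φ b.tgt = φ b.src) :
    toC (lineU U c) * φ (corner c.tgt) = φ (corner c.src) := by
  rw [toC_lineU, runC, show c.tgt = c.src.shift c.dir from rfl, corner_shift hj]
  exact prod_runBond_mul_eq_of hcov _ _ P.L fun t ht => runBond_corner_mem_starB hj c ht

end Transport

/-- **THE TRANSPORT RULE CLIMBS THE LEVELS INSIDE `Ω`**: if `u_bφ(b₊) = φ(b₋)` on `Ω*` then, at every level `k`,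
`u^{(k)}_c·(Q_k(u)φ)(c₊) = (Q_k(u)φ)(c₋)` for every bond `c` of `T^{(j+k)}` joining two INNER sites (both `k`-blocks inside `Ω`) — p11's
`transport_qCovK` with every bond used lying in `Ω*`. [cite: BalabanImbrieJaffe1985, (4.6.2) p.313] -/
theorem transport_qCovK_of {U : GaugeField P j U1} {φ : Balaban1983to89.Site P j → ℂ} {Ω : Finset (Balaban1983to89.Site P j)}
    (hcov : ∀ b ∈ starB Ω, toC (U b) * φ b.tgt = φ b.src) :
    ∀ (k : ℕ), j + k ≤ P.m + P.K →
      ∀ c ∈ starB (innerK k Ω), toC (lineIter U k c) * qCovK U k φ c.tgt = qCovK U k φ c.src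
  | 0, _, c, hc => hcov c (starB_subset_starB (fun y hy => mem_innerK_zero.1 hy) hc)
  | k + 1, hk, c, hc => by
    have hk' : j + k + 1 ≤ P.m + P.K := by omega
    have ih := transport_qCovK_of hcov k (by omega)
    obtain ⟨hs, ht⟩ := (mem_starB _ c).1 hc
    have es : qCovK U (k+1) φ c.src = qCovK U k φ (corner c.src) :=
      qCov_eq_corner_of hk' c.src fun b hb => ih b (starB_subset_starB (block_subset_innerK hs) hb)
    have et : qCovK U (k+1) φ c.tgt = qCovK U k φ (corner c.tgt) :=
      qCov_eq_corner_of hk' c.tgt fun b hb => ih b (starB_subset_starB (block_subset_innerK ht) hb)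
    rw [es, et, lineIter_succ]
    exact lineU_mul_eq_of hk' c fun b hb =>
      ih b (starB_subset_starB (union_subset (block_subset_innerK hs) (block_subset_innerK ht)) hb)

/-- **`(Q_k(u)φ)(y) = φ(y)`** (`y` read at its corner point) for every INNER `y`, as soon as the transport rule holds on `Ω*`.
[cite: BalabanImbrieJaffe1985, (4.6.2) p.313] -/
theorem qCovK_eq_cornerIter_of {U : GaugeField P j U1} {φ : Balaban1983to89.Site P j → ℂ} {Ω : Finset (Balaban1983to89.Site P j)}
    (hcov : ∀ b ∈ starB Ω, toC (U b) * φ b.tgt = φ b.src) :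
    ∀ (k : ℕ), j + k ≤ P.m + P.K → ∀ y ∈ innerK k Ω, qCovK U k φ y = φ (cornerIter k y)
  | 0, _, _, _ => rfl
  | k + 1, hk, y, hy => by
    have hk' : j + k + 1 ≤ P.m + P.K := by omega
    have ih := transport_qCovK_of hcov k (by omega)
    rw [qCovK_succ, qCov_eq_corner_of hk' y (fun b hb => ih b (starB_subset_starB (block_subset_innerK hy) hb)), cornerIter_succ]
    exact qCovK_eq_cornerIter_of hcov k (by omega) (corner y) (corner_mem_innerK hk' hy)

/-- **`u(Γ^{(k)}_{x_k,x})φ(x) = φ(x_k)`** (corner point of the `k`-block of `x`) whenever the transport rule holds on `Ω*` and the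
`(k+?)`-blocks along the contour lie inside `Ω`: precisely, for `B^k(x_k) ⊆ Ω`. [cite: BalabanImbrieJaffe1985, (5.1.2)–(5.1.3) p.313] -/
theorem holCK_mul_eq_of {U : GaugeField P j U1} {φ : Balaban1983to89.Site P j → ℂ} {Ω : Finset (Balaban1983to89.Site P j)}
    (hcov : ∀ b ∈ starB Ω, toC (U b) * φ b.tgt = φ b.src) :
    ∀ (k : ℕ), j + k ≤ P.m + P.K → ∀ x : Balaban1983to89.Site P j, blockK k (blkIter k x) ⊆ Ω →
      holCK U k x * φ x = φ (cornerIter k (blkIter k x))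
  | 0, _, _, _ => by rw [holCK_zero, one_mul]; rfl
  | k + 1, hk, x, hx => by
    have hk' : j + k + 1 ≤ P.m + P.K := by omega
    set z : Balaban1983to89.Site P (j+k) := blkIter k x with hz
    have hzk : blockK k z ⊆ Ω := (blockK_subset_blockK_succ k (mem_block_iff.2 rfl)).trans hx
    have hin : blockOf z ∈ innerK (k+1) Ω := mem_innerK.2 hx
    have ih := holCK_mul_eq_of hcov k (by omega) x hzk
    have tr := transport_qCovK_of hcov k (by omega)
    have hzi : z ∈ innerK k Ω := mem_innerK.2 hzk
    rw [holCK_succ, mul_assoc, ih, ← qCovK_eq_cornerIter_of hcov k (by omega) z hzi,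
      holC_mul_eq_corner_of hk' z (fun b hb => tr b (starB_subset_starB (block_subset_innerK hin) hb)),
      qCovK_eq_cornerIter_of hcov k (by omega) _ (corner_mem_innerK hk' hin)]
    rfl

/-- **NO ZERO MODES OF THE NEUMANN PROBLEM ON `Ω`** (the invertibility behind *"G_k(Ω,u) … with Neumann boundary conditions"*, p. 262,
and (I.4.6.2)): if `Ω` is a union of `k`-blocks, `D_uφ = 0` on the bonds `Ω*` and `Q_k(u)φ = 0` on the `k`-blocks inside `Ω`, then
`φ = 0` on `Ω` — for EVERY `U(1)` field `u` (`c ≠ 0`, standing range `j + k ≤ m + K`). [cite: BalabanImbrieJaffe1988, (2.27) p.263] -/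
theorem eq_zero_on_of_covD_qCovK {k : ℕ} (hk : j + k ≤ P.m + P.K) {c : ℝ} (hc : c ≠ 0) {U : GaugeField P j U1}
    {φ : Balaban1983to89.Site P j → ℂ} {Ω : Finset (Balaban1983to89.Site P j)} (hΩ : IsBlockUnion k Ω)
    (hD : ∀ b ∈ starB Ω, covD c (cfg U) φ b = 0) (hQ : ∀ y ∈ innerK k Ω, qCovK U k φ y = 0) :
    ∀ x ∈ Ω, φ x = 0 := by
  have hcov : ∀ b ∈ starB Ω, toC (U b) * φ b.tgt = φ b.src := fun b hb => (covD_eq_zero_iff hc (cfg U) φ b).1 (hD b hb)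
  intro x hx
  have h := holCK_mul_eq_of hcov k hk x (hΩ x hx)
  rw [← qCovK_eq_cornerIter_of hcov k hk _ (hΩ.blkIter_mem hx), hQ _ (hΩ.blkIter_mem hx), mul_eq_zero] at h
  exact h.resolve_left (holCK_ne_zero U k x)


end

end Literature.MathematicalPhysics.QuantumFieldTheory.BalabanImbrieJaffe1984to88.BIJ88NeumannNoZeroModesTorus
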